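import Mathlib.Analysis.SpecialFunctions.Log.Basic
import Mathlib.Analysis.SpecialFunctions.Pow.Real
import Mathlib.Analysis.SpecialFunctions.Log.Base
import Mathlib.Analysis.Convex.SpecificFunctions.Basic
import HarnessLib

/-!
# Complexity of the barrier method: Newton iterations per centering step and the `O(√m)` bound
# (Boyd–Vandenberghe 2004, §11.5.2–§11.5.3)

Topic `Literature/Analysis/Convex`; namespace `Literature.Analysis.Convex.BarrierComplexity`.
Everything here is PROVED; no definitions, no named facts.

Setting [BV04 §11.5]: the barrier method for `minimize f₀(x) s.t. fᵢ(x) ≤ 0 (i = 1..m), Ax = b`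
minimises `t f₀ + φ`, `φ(x) = −∑ log(−fᵢ(x))`, for `t = t⁽⁰⁾, μt⁽⁰⁾, μ²t⁽⁰⁾, …`. Write `x = x⋆(t)`
for the current central point, `x⁺ = x⋆(μt)` for the next one, `λᵢ = λᵢ⋆(t) = −1/(t fᵢ(x))`,
`ν = ν⋆(t)`; by (11.10) `(λ, ν)` is dual feasible with `g(λ, ν) = f₀(x) − m/t`, so in particular
`f₀(x) − m/t = g(λ, ν) ≤ L(x⁺, λ, ν) = f₀(x⁺) + ∑ λᵢ fᵢ(x⁺)` (as `Ax⁺ = b`). With the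
self-concordance bound (11.24) "`#Newton steps ≤ (f(x) − p⋆)/γ + c`" the number of Newton steps of
one outer iteration is at most (11.25) `(μt f₀(x) + φ(x) − μt f₀(x⁺) − φ(x⁺))/γ + c`, and the chain
of (in)equalities on p. 0459 of the scan bounds the numerator:

  `μt f₀(x) + φ(x) − μt f₀(x⁺) − φ(x⁺) ≤ m(μ − 1 − log μ)`                    (⇒ (11.26))

(`centering_decrease_le`; hypotheses exactly the three facts used in the book's chain: strict
feasibility of `x`, `x⁺`, `λᵢ = −1/(t fᵢ(x))`, and the Lagrangian lower bound displayed above —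
the latter is `Literature.Analysis.Convex.CentralPath.CentralityKKT.isMinOn_lagrangian` /
`lagrangian_eq` of `LogBarrierCentralPath.lean` for convex data), whence the per-centering bound
(11.26) `m(μ − 1 − log μ)/γ + c` (`newton_steps_per_centering_le`). §11.5.3: multiplying by the
number `⌈log(m/(t⁽⁰⁾ε))/log μ⌉` of outer iterations ((11.13), in the tree as
`CentralPath.gap_le_iff_ceil_le`) gives (11.27); with the choice (11.28) `μ = 1 + 1/√m` one has
`μ − 1 − log μ ≤ 1/(2m)` (`mu_sub_one_sub_log_le`; the book's "`−log(1+a) ≤ −a + a²/2` for `a ≥ 0`"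
follows from Mathlib's sharper `Real.le_log_one_add_of_nonneg : 2a/(a+2) ≤ log(1+a)` and is already
in the tree as `Literature.NumberTheory.LFunctions.NicolasK.log_one_add_ge`, so it is not restated) and `log μ ≥ (log 2)/√m` (concavity of `log`: `log_two_div_sqrt_le`), so
the total is at most `⌈√m log₂(m/(t⁽⁰⁾ε))⌉ (1/(2γ) + c)` (11.29) (`total_newton_steps_sqrt_bound`):
"the barrier method, with parameter value (11.28), is said to be an order `√m` method".

Not formalised: the self-concordance hypothesis of §11.5.1 and the Newton bound (11.24) itself
(§9.6.4 — taken as the hypothesis `hN`), the existence of the central points, the numerical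
discussion of figure 11.14, §11.5.4–§11.5.6 (feasibility, combined phase I/II).

## References

* S. Boyd, L. Vandenberghe, *Convex Optimization*, Cambridge University Press (2004), §11.5.2
  (11.24)–(11.26), §11.5.3 (11.27)–(11.29). [BoydVandenberghe2004] (held scan
  [galaxy:panama:376041566634042], text of §11.5.1–§11.5.3 read)
-/

open Set

namespace Literature.Analysis.Convex.BarrierComplexity

/-! ## §11.5.2 Newton iterations per centering step -/

section Centering

variable {X : Type*} {ι : Type*} [Fintype ι]

/-- The per-constraint step of the chain: with `λᵢ = −1/(t fᵢ(x)) > 0` and `fᵢ(x), fᵢ(x⁺) < 0`,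
`log(−fᵢ(x⁺)) − log(−fᵢ(x)) = log(−μtλᵢfᵢ(x⁺)) − log μ ≤ −μtλᵢfᵢ(x⁺) − 1 − log μ`
("we use `λᵢ = −1/(tfᵢ(x))`" and "`log a ≤ a − 1` for `a > 0`").
[cite: BoydVandenberghe2004, §11.5.2 derivation of (11.26)] -/
theorem log_neg_sub_log_neg_le {t μ a b lam : ℝ} (ht : 0 < t) (hμ : 0 < μ) (ha : a < 0)
    (hb : b < 0) (hlam : lam = -1 / (t * a)) :
    Real.log (-b) - Real.log (-a) ≤ -(μ * t) * (lam * b) - 1 - Real.log μ := by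
  have hta : t * a ≠ 0 := mul_ne_zero ht.ne' ha.ne
  have hq : 0 < b / a := div_pos_of_neg_of_neg hb ha
  have hkey : -(μ * t) * (lam * b) = μ * (b / a) := by
    rw [hlam]
    field_simp
  have hpos : 0 < μ * (b / a) := mul_pos hμ hq
  have hlog : Real.log (μ * (b / a)) = Real.log μ + (Real.log (-b) - Real.log (-a)) := by
    rw [Real.log_mul hμ.ne' hq.ne', ← neg_div_neg_eq, Real.log_div (neg_ne_zero.2 hb.ne)
      (neg_ne_zero.2 ha.ne)]
  have h1 := Real.log_le_sub_one_of_pos hpos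
  rw [hkey]
  linarith

/-- **Decrease of the centering objective over one outer iteration** (the chain of (in)equalities
leading to (11.26)): for `t > 0`, `μ > 0`, strictly feasible `x` (current central point) and `x⁺`
(next central point), `λᵢ = −1/(t fᵢ(x))`, and the Lagrangian lower bound
`f₀(x) − m/t = g(λ, ν) ≤ f₀(x⁺) + ∑ λᵢ fᵢ(x⁺)` (`Ax⁺ = b`), one has
`μt f₀(x) + φ(x) − μt f₀(x⁺) − φ(x⁺) ≤ m(μ − 1 − log μ)`, `φ = −∑ log(−fᵢ)`, `m` the number of
inequality constraints. Only the values at `x`, `x⁺` enter, so `X` is an arbitrary type.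
[cite: BoydVandenberghe2004, §11.5.2 (11.25)-(11.26)] -/
theorem centering_decrease_le (f₀ : X → ℝ) (f : ι → X → ℝ) {t μ : ℝ} {x xp : X} {lam : ι → ℝ}
    (ht : 0 < t) (hμ : 0 < μ) (hx : ∀ i, f i x < 0) (hxp : ∀ i, f i xp < 0)
    (hlam : ∀ i, lam i = -1 / (t * f i x))
    (hlow : f₀ x - (Fintype.card ι : ℝ) / t ≤ f₀ xp + ∑ i, lam i * f i xp) :
    (μ * t * f₀ x - ∑ i, Real.log (-(f i x))) - (μ * t * f₀ xp - ∑ i, Real.log (-(f i xp)))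
      ≤ (Fintype.card ι : ℝ) * (μ - 1 - Real.log μ) := by
  -- sum of the per-constraint inequalities
  have hsum : ∑ i, (Real.log (-(f i xp)) - Real.log (-(f i x))) ≤
      ∑ i, (-(μ * t) * (lam i * f i xp) - 1 - Real.log μ) :=
    Finset.sum_le_sum fun i _ => log_neg_sub_log_neg_le ht hμ (hx i) (hxp i) (hlam i)
  rw [Finset.sum_sub_distrib] at hsum
  have hrhs : ∑ i, (-(μ * t) * (lam i * f i xp) - 1 - Real.log μ) =
      -(μ * t) * ∑ i, lam i * f i xp - (Fintype.card ι : ℝ) * (1 + Real.log μ) := by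
    rw [Finset.sum_sub_distrib, Finset.sum_sub_distrib, ← Finset.mul_sum, Finset.sum_const,
      Finset.sum_const, Finset.card_univ, nsmul_eq_mul, nsmul_eq_mul]
    ring
  rw [hrhs] at hsum
  -- the Lagrangian lower bound, multiplied by `μ t > 0`
  have hμt : 0 < μ * t := mul_pos hμ ht
  have hlow' : μ * t * (f₀ x - (f₀ xp + ∑ i, lam i * f i xp)) ≤ μ * (Fintype.card ι : ℝ) := by
    have h1 : f₀ x - (f₀ xp + ∑ i, lam i * f i xp) ≤ (Fintype.card ι : ℝ) / t := by linarith
    have h2 := mul_le_mul_of_nonneg_left h1 hμt.le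
    have h3 : μ * t * ((Fintype.card ι : ℝ) / t) = μ * (Fintype.card ι : ℝ) := by
      field_simp
    linarith
  nlinarith

/-- **Newton iterations per centering step** (11.26): if the number `N` of Newton steps needed to
compute `x⁺ = x⋆(μt)` from `x = x⋆(t)` obeys the self-concordance bound (11.24)/(11.25)
`N ≤ (F(x) − F(x⁺))/γ + c` for the centering objective `F = μt f₀ + φ` (whose minimum is `F(x⁺)`),
then `N ≤ m(μ − 1 − log μ)/γ + c`. [cite: BoydVandenberghe2004, §11.5.2 (11.26)] -/
theorem newton_steps_per_centering_le {N γ c Fx Fxp m μ : ℝ} (hγ : 0 < γ)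
    (hN : N ≤ (Fx - Fxp) / γ + c) (hdec : Fx - Fxp ≤ m * (μ - 1 - Real.log μ)) :
    N ≤ m * (μ - 1 - Real.log μ) / γ + c :=
  hN.trans (by gcongr)

/-- The function `μ − 1 − log μ` of figure 11.13 is nonnegative (`log μ ≤ μ − 1`).
[cite: BoydVandenberghe2004, §11.5.2 figure 11.13] -/
theorem sub_one_sub_log_nonneg {μ : ℝ} (hμ : 0 < μ) : 0 ≤ μ - 1 - Real.log μ := by
  have := Real.log_le_sub_one_of_pos hμ
  linarith

end Centering

/-! ## §11.5.3 Total number of Newton iterations; `μ = 1 + 1/√m` -/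

/-- With `μ = 1 + 1/√m` (11.28): `μ − 1 − log μ = 1/√m − log(1 + 1/√m) ≤ 1/(2m)`
("using `−log(1 + a) ≤ −a + a²/2` for `a ≥ 0`", here obtained from Mathlib's
`Real.le_log_one_add_of_nonneg`). [cite: BoydVandenberghe2004, §11.5.3 (11.28)-(11.29)] -/
theorem mu_sub_one_sub_log_le {m μ : ℝ} (hm : 0 < m) (hμ : μ = 1 + 1 / Real.sqrt m) :
    μ - 1 - Real.log μ ≤ 1 / (2 * m) := by
  set a : ℝ := 1 / Real.sqrt m with ha_def
  have ha : 0 ≤ a := by positivity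
  -- `a − a²/2 ≤ 2a/(a+2) ≤ log(1 + a)`
  have h1 : a - a ^ 2 / 2 ≤ 2 * a / (a + 2) := by
    rw [le_div_iff₀ (by linarith)]
    nlinarith [sq_nonneg a, mul_nonneg ha (sq_nonneg a)]
  have h2 := Real.le_log_one_add_of_nonneg ha
  have hsq : a ^ 2 = 1 / m := by
    rw [ha_def, div_pow, one_pow, Real.sq_sqrt hm.le]
  rw [hμ]
  have : 1 / m / 2 = 1 / (2 * m) := by ring
  linarith

/-- "Using concavity of the logarithm, we also have `log μ = log(1 + 1/√m) ≥ (log 2)/√m`"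
(for `m ≥ 1`, so that `1/√m ∈ (0, 1]`: `log` lies above its chord between `1` and `2`).
[cite: BoydVandenberghe2004, §11.5.3 derivation of (11.29)] -/
theorem log_two_div_sqrt_le {m μ : ℝ} (hm : 1 ≤ m) (hμ : μ = 1 + 1 / Real.sqrt m) :
    Real.log 2 / Real.sqrt m ≤ Real.log μ := by
  set a : ℝ := 1 / Real.sqrt m with ha_def
  have hsqrt : 1 ≤ Real.sqrt m := by
    rw [show (1 : ℝ) = Real.sqrt 1 by simp]
    exact Real.sqrt_le_sqrt hm
  have ha0 : 0 ≤ a := by positivity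
  have ha1 : a ≤ 1 := by
    rw [ha_def, div_le_one (by positivity)]
    exact hsqrt
  have hconc := (strictConcaveOn_log_Ioi).concaveOn.2 (x := 1) (y := 2) (by norm_num) (by norm_num)
    (sub_nonneg.2 ha1) ha0 (sub_add_cancel 1 a)
  simp only [smul_eq_mul, Real.log_one, mul_zero, zero_add] at hconc
  have hμ' : μ = (1 - a) * 1 + a * 2 := by rw [hμ, ha_def]; ring
  rw [hμ', show Real.log 2 / Real.sqrt m = a * Real.log 2 by rw [ha_def]; ring]
  exact hconc

/-- **The barrier method is an order-`√m` method** (11.29): with `μ = 1 + 1/√m`, the total bound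
(11.27) `N = ⌈log(m/(t⁽⁰⁾ε))/log μ⌉ (m(μ − 1 − log μ)/γ + c)` satisfies
`N ≤ ⌈√m log₂(m/(t⁽⁰⁾ε))⌉ (1/(2γ) + c)` (`= c₁ + c₂√m` up to the ceiling), for a duality-gap
reduction factor `R = m/(t⁽⁰⁾ε) ≥ 1`, `m ≥ 1`, `γ > 0`, `c ≥ 0`.
[cite: BoydVandenberghe2004, §11.5.3 (11.27)-(11.29)] -/
theorem total_newton_steps_sqrt_bound {m R γ c μ : ℝ} (hm : 1 ≤ m) (hR : 1 ≤ R) (hγ : 0 < γ)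
    (hc : 0 ≤ c) (hμ : μ = 1 + 1 / Real.sqrt m) :
    ((⌈Real.log R / Real.log μ⌉ : ℤ) : ℝ) * (m * (μ - 1 - Real.log μ) / γ + c) ≤
      ((⌈Real.sqrt m * Real.logb 2 R⌉ : ℤ) : ℝ) * (1 / (2 * γ) + c) := by
  have hm0 : 0 < m := by linarith
  have hlogR : 0 ≤ Real.log R := Real.log_nonneg hR
  have hsqrt : 0 < Real.sqrt m := Real.sqrt_pos.2 hm0
  have hlog2 : 0 < Real.log 2 := Real.log_pos (by norm_num)
  have hlogμ_ge : Real.log 2 / Real.sqrt m ≤ Real.log μ := log_two_div_sqrt_le hm hμ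
  have hlogμ : 0 < Real.log μ := lt_of_lt_of_le (div_pos hlog2 hsqrt) hlogμ_ge
  -- first factor: `log R / log μ ≤ √m log₂ R`
  have h1 : Real.log R / Real.log μ ≤ Real.sqrt m * Real.logb 2 R := by
    rw [Real.logb, div_le_iff₀ hlogμ]
    calc Real.log R = Real.sqrt m * (Real.log R / Real.log 2) * (Real.log 2 / Real.sqrt m) := by
          field_simp
      _ ≤ Real.sqrt m * (Real.log R / Real.log 2) * Real.log μ :=
          mul_le_mul_of_nonneg_left hlogμ_ge (by positivity)
  have h1' : ((⌈Real.log R / Real.log μ⌉ : ℤ) : ℝ) ≤ ((⌈Real.sqrt m * Real.logb 2 R⌉ : ℤ) : ℝ) := by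
    exact_mod_cast Int.ceil_mono h1
  have h1nn : (0 : ℝ) ≤ ((⌈Real.sqrt m * Real.logb 2 R⌉ : ℤ) : ℝ) := by
    have : (0 : ℝ) ≤ Real.sqrt m * Real.logb 2 R :=
      mul_nonneg hsqrt.le (Real.logb_nonneg (by norm_num) hR)
    exact_mod_cast Int.ceil_nonneg this
  -- second factor: `m(μ − 1 − log μ)/γ + c ≤ 1/(2γ) + c`
  have h2 : m * (μ - 1 - Real.log μ) / γ + c ≤ 1 / (2 * γ) + c := by
    have hle : m * (μ - 1 - Real.log μ) ≤ 1 / 2 := by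
      have := mul_le_mul_of_nonneg_left (mu_sub_one_sub_log_le hm0 hμ) hm0.le
      have h3 : m * (1 / (2 * m)) = 1 / 2 := by field_simp
      linarith
    have : m * (μ - 1 - Real.log μ) / γ ≤ 1 / (2 * γ) := by
      rw [div_le_iff₀ hγ]
      have h4 : 1 / (2 * γ) * γ = 1 / 2 := by field_simp
      linarith
    linarith
  have h2nn : 0 ≤ m * (μ - 1 - Real.log μ) / γ + c := by
    have : 0 ≤ m * (μ - 1 - Real.log μ) :=
      mul_nonneg hm0.le (sub_one_sub_log_nonneg (by rw [hμ]; positivity))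
    positivity
  exact mul_le_mul h1' h2 h2nn h1nn

end Literature.Analysis.Convex.BarrierComplexity
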